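import Summits.ABC.IUTFork.Cor312PinnedHonestInflationNV
import Summits.ABC.IUTFork.Repair.CandMochizuki31Tests
import HarnessLib

/-!
# REPAIR branch B1 / CandMochizuki31 — [IUTchIV] Rmk 2.3.2 (ii) with [IUTchIII] Rmk 3.12.1 (ii) / Step (xi-h): the N-th POWER of the étale
# theta function as a MODEL CLASS `H N` («N-th-power honest scaling»), and the inflation budget it demands — row RP-M31 (diagnostic)

CANDIDATE file (class `Mochizuki`, sub-cell B1, seat abc-iut-rp-m3; rung LADDER-ABC:A2.RP ⊆ A2.B; REPAIR-SPEC v0.3 §2/§3; row RP-M31 =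
rp-lit-2's [IUTchIV] row V-19). HYPOTHESIS, NOT ASSERTED; typed ≠ proved; instantiated ≠ endorsed. TAKES NO SIDE between Mochizuki,
Scholze–Stix or anyone; nothing here asserts abc or [IUTchIII] Cor. 3.12 proved or refuted. Sources: S. Mochizuki, *IUT IV*, kurims (Apr
2020) = `paper:url-56bcb0f95768`; *IUT III*, kurims (May 2020) = `paper:url-4b091feeb646`. [claim: Mochizuki2012, status: disputed]

SOURCE (verbatim). [IUTchIV] Rmk 2.3.2 (ii), p. 56 l. 40–47: «we observe that the constant "1" in the inequality of the display of
Corollary 2.3 cannot be improved — cf. the examples constructed in [Mss]; the discussion of Remark 1.10.5, (ii), (iii). This observation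
is closely related to discussions of how the theory of the present series of papers breaks down if one attempts to replace the first power
of the étale theta function by its N-th power for some integer N ≥ 2 [cf. the discussion in the final portion of Step (xi) of the proof of
[IUTchIII], Corollary 3.12; the discussion of [IUTchIII], Remark 3.12.1, (ii)].» [IUTchIII] Rmk 3.12.1 (ii), p. 186 l. 8–16: generalized
Θ×μ_LGP-links «q^λ ↦ q^{(1², …, (l⋇)²)}», «C_Θ ≥ −λ … sharper, for λ < 1» (typed at the two-number level by abc-iut-c312-8,
`Cor312Rmk.GeneralizedVolumes`, not imported); Step (xi-h), p. 185 l. 48–58 (the N-th power «violates cyclotomic rigidity … [EtTh]»).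

READING CHOICES. «replace the first power of the étale theta function by its N-th power» ↦ the pinned Θ-image region at label `j` has
log-volume `N·j²` times the q-pilot's local log-volume (the values `q^{j²}` become `q^{N·j²}`; `N = 1` IS abc-iut-w4-d103's honesty clause
`hscaled` of `PinnedHonest.statement_iff_hullInflation`, p425829) — a MODEL CLASS `H N` over PR-1's pinned reading (`ρ`, the line's
Θ-datum `Ψ`), NOT a supplier; «breaks down / sharper inequalities are false» ↦ the typed shadow below: on `H N`-models the typed Corollary
demands `N`-fold inflation. What print locates as the REASON (cyclotomic rigidity of [EtTh] holds for the first power only) is not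
expressible over the frozen interface (cf. `Thm311ToCor312` module docstring: «(xi-h)'s "false for N ≥ 2" is a constraint on MODELS»);
sub-cell B0 rp-d1 (RP-I03/I04) types the [EtTh] supplier.

CENSUS (kernel, this file). `statement_iff_hullInflation_pow`: on a pin-respecting setting with `ThetaFinite`, label-independent q-volume,
Thm 3.11 (ii)(b) and `H N`, Statement ⟺ `(N·PN(j²) − 1)·|log(q)| ≤ PN(Σᶠ [logvol ⁿ˒°𝒰 − logvol thetaRegion3])` (N = 1: w4-d103's identity);
`height_bound_pow` / `supplier_false_of_cap_lt_pow`: with a cap `s` on the inflation ([IUTchIV] Step (v), RP-M06 `CandMochizuki30.H`),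
every Statement-supplier forces `(N·PN(j²) − 1)·|log(q)| ≤ PN Σ s` and is FALSE below that budget — the same cap pays for the N-th-power link
only at N-fold smaller height: the typed form of «the sharper inequalities for N ≥ 2 are false / the theory breaks down» GIVEN that print's cap
does not grow with N. `coeff_pow_ge`: the budget coefficient is `≥ (5N − 2)/2`. T-b: `H_pinned_iff : H N ⟺ N = 1` at the pinned
countermodel (so `H N`, N ≥ 2, FAILS-AT-CM — but it is a model class, T-a n/a: it implies nothing q/Θ-relating by itself); T-c for N ≥ 2:
OPEN — no N-th-power model of record (it needs a situation whose Θ-monoid is `{(±q^{N j²})_j}`: abc-iut-w4-d026's generic theta families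
`Cor312NaiveProvPinnedThm311` would carry it; not built here). Diagnostic row; nothing asserted.
-/

noncomputable section

open Set

namespace Summit.ABC.IUTFork.Repair.CandMochizuki31

open Thm311 Cor312 Cor312Vol Cor312Vol.PinnedHonest Literature.IUT.LogThetaLattice

variable {T : ThetaIndex}

/-! ## 1. The model class: N-th-power honest scaling -/

/-- **CANDIDATE / MODEL CLASS `H N` (class Mochizuki, sub-cell B1, row RP-M31) — hypothesis, NOT asserted; typed ≠ proved.** SOURCE:
[IUTchIV] `paper:url-56bcb0f95768` Rmk 2.3.2 (ii) p. 56 l. 40–47 («replace the first power of the étale theta function by its N-th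
power for some integer N ≥ 2»); [IUTchIII] `paper:url-4b091feeb646` Rmk 3.12.1 (ii) p. 186 l. 8–16, Step (xi-h) p. 185 l. 48–58. LEVEL:
none (model class; diagnostic). Informal reading: in every packet at a label `j ∈ 𝔽_l^⋇`, the `ρ`-region of the line's Θ-splitting-monoid
datum (the pinned Θ-image) has log-volume `N·j²` times the q-pilot's local log-volume — the link glues `q` to `{q^{N·j²}}_j`. `N = 1` is the
honesty clause `hscaled` of record. [claim: Mochizuki2012, status: disputed] -/
@[claim "Mochizuki2012" "disputed"]
def H (S : LatticeSituation T) (P : Cor312.Setting S.toSituation)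
    (ρ : (∀ v : T.V, v ∈ T.Vbad → Set (S.L.StarPacket v)) → ∀ (j : T.Label) (vQ : T.VQ), Set (S.L.Packet j vQ))
    (_qK : ∀ v : T.V, v ∈ T.Vbad → Set (S.L.StarPacket v)) (N : ℕ) : Prop :=
  ∀ (i : Fin T.lstar) (vQ : T.VQ),
    (S.D P.n).logvol _ vQ (ρ (S.D P.n).Ψ (Setting.labelSucc i) vQ) =
      (N : ℝ) * (((i : ℕ) + 1 : ℕ) : ℝ) ^ 2 * P.qLocal (Setting.labelSucc i) vQ

section General

variable (S : LatticeSituation T) (P : Cor312.Setting S.toSituation)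
  (ρ : (∀ v : T.V, v ∈ T.Vbad → Set (S.L.StarPacket v)) → ∀ (j : T.Label) (vQ : T.VQ), Set (S.L.Packet j vQ))
  (qK : ∀ v : T.V, v ∈ T.Vbad → Set (S.L.StarPacket v))

/-- `N = 1` is abc-iut-w4-d103's honest `j²`-scaling clause `hscaled` (p418630 / p425829). [folklore] -/
theorem H_one_iff : H S P ρ qK 1 ↔ ∀ (i : Fin T.lstar) (vQ : T.VQ),
    (S.D P.n).logvol _ vQ (ρ (S.D P.n).Ψ (Setting.labelSucc i) vQ) =
      (((i : ℕ) + 1 : ℕ) : ℝ) ^ 2 * P.qLocal (Setting.labelSucc i) vQ := by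
  simp only [H, Nat.cast_one, one_mul]

/-! ## 2. The budget identity for the N-th-power link -/

/-- **THE TYPED COROLLARY ON AN N-th-POWER PIN-RESPECTING SETTING IS THE N-FOLD HULL-INFLATION INEQUALITY.** Under `ThetaFinite`, a
label-independent q-volume, the Θ-pin (pΘ), Thm 3.11 (ii)(b) for the column and `H N`:
`Statement ↔ (N·PN(j²) − 1)·(−(−|log(q)|)) ≤ PN(i ↦ Σᶠ_{v_ℚ} [logvol ⁿ˒°𝒰_{i+1,v_ℚ} − logvol thetaRegion3_{i+1,v_ℚ}])`. For `N = 1` this is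
w4-d103's `statement_iff_hullInflation`; the right side (the hull's gain over the Kummer image, where [IUTchIV] Thm 1.10 Step (v) computes)
does not see `N`, the left side grows linearly in `N`. [claim: Mochizuki2012, status: disputed] -/
theorem statement_iff_hullInflation_pow (N : ℕ) (hfin : P.ThetaFinite)
    (hindep : ∀ (i i' : Fin T.lstar) (vQ : T.VQ), P.qLocal (Setting.labelSucc i) vQ = P.qLocal (Setting.labelSucc i') vQ)
    (hKumB : (S.col P.n).KummerB (S.D P.n)) (hΘ : ThetaPinned S P ρ) (h : H S P ρ qK N) :
    P.Statement ↔
      ((N : ℝ) * processionNormalized (fun i : Fin T.lstar => (((i : ℕ) + 1 : ℕ) : ℝ) ^ 2) - 1) * (-P.negLogQ) ≤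
        processionNormalized (fun i : Fin T.lstar =>
          ∑ᶠ vQ : T.VQ, ((S.D P.n).logvol _ vQ (P.thetaHull (Setting.labelSucc i) vQ) -
            (S.D P.n).logvol _ vQ (P.thetaRegion3 (Setting.labelSucc i) vQ))) := by
  rw [statement_iff_weightedExcess S P hfin hindep]
  -- per label: Σᶠ (hull − j²·q) = Σᶠ (hull − region3) + (N − 1)·j²·(−|log q|)
  have hlabel : ∀ i : Fin T.lstar,
      ∑ᶠ vQ : T.VQ, ((S.D P.n).logvol _ vQ (P.thetaHull (Setting.labelSucc i) vQ) -
          (((i : ℕ) + 1 : ℕ) : ℝ) ^ 2 * P.qLocal (Setting.labelSucc i) vQ) =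
        ∑ᶠ vQ : T.VQ, ((S.D P.n).logvol _ vQ (P.thetaHull (Setting.labelSucc i) vQ) -
            (S.D P.n).logvol _ vQ (P.thetaRegion3 (Setting.labelSucc i) vQ)) +
          ((N : ℝ) - 1) * (((i : ℕ) + 1 : ℕ) : ℝ) ^ 2 * P.negLogQ := by
    intro i
    have hq : (Function.support fun vQ : T.VQ => P.qLocal (Setting.labelSucc i) vQ).Finite := P.qSupport_finite _
    have hθ3 : ∀ vQ : T.VQ, (S.D P.n).logvol _ vQ (P.thetaRegion3 (Setting.labelSucc i) vQ) =
        (N : ℝ) * (((i : ℕ) + 1 : ℕ) : ℝ) ^ 2 * P.qLocal (Setting.labelSucc i) vQ := fun vQ => by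
      rw [thetaRegion3_eq_of_thetaPinned S P ρ hKumB hΘ, h i vQ]
    have hsplit : (fun vQ : T.VQ => (S.D P.n).logvol _ vQ (P.thetaHull (Setting.labelSucc i) vQ) -
          (((i : ℕ) + 1 : ℕ) : ℝ) ^ 2 * P.qLocal (Setting.labelSucc i) vQ) =
        fun vQ => ((S.D P.n).logvol _ vQ (P.thetaHull (Setting.labelSucc i) vQ) -
            (S.D P.n).logvol _ vQ (P.thetaRegion3 (Setting.labelSucc i) vQ)) +
          ((N : ℝ) - 1) * (((i : ℕ) + 1 : ℕ) : ℝ) ^ 2 * P.qLocal (Setting.labelSucc i) vQ := by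
      funext vQ; rw [hθ3 vQ]; ring
    have hinfl : (Function.support fun vQ : T.VQ => (S.D P.n).logvol _ vQ (P.thetaHull (Setting.labelSucc i) vQ) -
        (S.D P.n).logvol _ vQ (P.thetaRegion3 (Setting.labelSucc i) vQ)).Finite := by
      refine Function.HasFiniteSupport.sub (hullVol_support_finite S P hfin i) ?_
      have heq : (fun vQ : T.VQ => (S.D P.n).logvol _ vQ (P.thetaRegion3 (Setting.labelSucc i) vQ)) =
          fun vQ => ((N : ℝ) * (((i : ℕ) + 1 : ℕ) : ℝ) ^ 2) * P.qLocal (Setting.labelSucc i) vQ := by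
        funext vQ; rw [hθ3 vQ]
      rw [heq]
      exact hq.subset (Function.support_mul_subset_right _ _)
    have hwq : (Function.support fun vQ : T.VQ =>
        ((N : ℝ) - 1) * (((i : ℕ) + 1 : ℕ) : ℝ) ^ 2 * P.qLocal (Setting.labelSucc i) vQ).Finite := by
      have heq : (fun vQ : T.VQ => ((N : ℝ) - 1) * (((i : ℕ) + 1 : ℕ) : ℝ) ^ 2 * P.qLocal (Setting.labelSucc i) vQ) =
          fun vQ => (((N : ℝ) - 1) * (((i : ℕ) + 1 : ℕ) : ℝ) ^ 2) * P.qLocal (Setting.labelSucc i) vQ := by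
        funext vQ; ring
      rw [heq]
      exact hq.subset (Function.support_mul_subset_right _ _)
    rw [hsplit, finsum_add_distrib hinfl hwq]
    congr 1
    have heq : (fun vQ : T.VQ => ((N : ℝ) - 1) * (((i : ℕ) + 1 : ℕ) : ℝ) ^ 2 * P.qLocal (Setting.labelSucc i) vQ) =
        fun vQ => (((N : ℝ) - 1) * (((i : ℕ) + 1 : ℕ) : ℝ) ^ 2) * P.qLocal (Setting.labelSucc i) vQ := by
      funext vQ; ring
    rw [heq, ← mul_finsum (fun vQ : T.VQ => P.qLocal (Setting.labelSucc i) vQ) _, finsum_qLocal_eq_negLogQ S P hindep i]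
  have hPN : processionNormalized (fun i : Fin T.lstar =>
        ∑ᶠ vQ : T.VQ, ((S.D P.n).logvol _ vQ (P.thetaHull (Setting.labelSucc i) vQ) -
          (((i : ℕ) + 1 : ℕ) : ℝ) ^ 2 * P.qLocal (Setting.labelSucc i) vQ)) =
      processionNormalized (fun i : Fin T.lstar =>
        ∑ᶠ vQ : T.VQ, ((S.D P.n).logvol _ vQ (P.thetaHull (Setting.labelSucc i) vQ) -
          (S.D P.n).logvol _ vQ (P.thetaRegion3 (Setting.labelSucc i) vQ))) +
        ((N : ℝ) - 1) * processionNormalized (fun i : Fin T.lstar => (((i : ℕ) + 1 : ℕ) : ℝ) ^ 2) * P.negLogQ := by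
    simp only [hlabel]
    unfold processionNormalized
    rw [Finset.sum_add_distrib, add_div]
    congr 1
    have : ∑ i : Fin T.lstar, ((N : ℝ) - 1) * (((i : ℕ) + 1 : ℕ) : ℝ) ^ 2 * P.negLogQ =
        (((N : ℝ) - 1) * P.negLogQ) * ∑ i : Fin T.lstar, (((i : ℕ) + 1 : ℕ) : ℝ) ^ 2 := by
      rw [Finset.mul_sum]; exact Finset.sum_congr rfl fun i _ => by ring
    rw [this]
    ring
  rw [hPN]
  constructor <;> intro hle <;> nlinarith [hle]

/-- **The height bound on an N-th-power setting** ([IUTchIV] Thm 1.10 Step (viii) shape): the typed Corollary together with a cap `s`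
on the hull inflation (Step (v); RP-M06 `CandMochizuki30.H`) forces `(N·PN(j²) − 1)·|log(q)| ≤ PN(i ↦ Σᶠ_{v_ℚ} s)`.
[claim: Mochizuki2012, status: disputed] -/
theorem height_bound_pow (N : ℕ) (hfin : P.ThetaFinite)
    (hindep : ∀ (i i' : Fin T.lstar) (vQ : T.VQ), P.qLocal (Setting.labelSucc i) vQ = P.qLocal (Setting.labelSucc i') vQ)
    (hKumB : (S.col P.n).KummerB (S.D P.n)) (hΘ : ThetaPinned S P ρ) (h : H S P ρ qK N)
    (s : Fin T.lstar → T.VQ → ℝ) (hs : ∀ i, (Function.support (s i)).Finite)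
    (hcap : ∀ (i : Fin T.lstar) (vQ : T.VQ),
      (S.D P.n).logvol _ vQ (P.thetaHull (Setting.labelSucc i) vQ) -
        (S.D P.n).logvol _ vQ (P.thetaRegion3 (Setting.labelSucc i) vQ) ≤ s i vQ)
    (hS : P.Statement) :
    ((N : ℝ) * processionNormalized (fun i : Fin T.lstar => (((i : ℕ) + 1 : ℕ) : ℝ) ^ 2) - 1) * (-P.negLogQ) ≤
      processionNormalized (fun i : Fin T.lstar => ∑ᶠ vQ : T.VQ, s i vQ) := by
  have h1 := (statement_iff_hullInflation_pow S P ρ qK N hfin hindep hKumB hΘ h).1 hS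
  refine h1.trans (Cor312Vol.processionNormalized_mono fun i => ?_)
  have hq : (Function.support fun vQ : T.VQ => P.qLocal (Setting.labelSucc i) vQ).Finite := P.qSupport_finite _
  have hθ3 : (Function.support fun vQ : T.VQ =>
      (S.D P.n).logvol _ vQ (P.thetaRegion3 (Setting.labelSucc i) vQ)).Finite := by
    have heq : (fun vQ : T.VQ => (S.D P.n).logvol _ vQ (P.thetaRegion3 (Setting.labelSucc i) vQ)) =
        fun vQ => ((N : ℝ) * (((i : ℕ) + 1 : ℕ) : ℝ) ^ 2) * P.qLocal (Setting.labelSucc i) vQ := by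
      funext vQ
      rw [thetaRegion3_eq_of_thetaPinned S P ρ hKumB hΘ, h i vQ]
    rw [heq]
    exact hq.subset (Function.support_mul_subset_right _ _)
  exact finsum_le_finsum' (Function.HasFiniteSupport.sub (hullVol_support_finite S P hfin i) hθ3) (hs i)
    fun vQ => hcap i vQ

/-- **Every Statement-supplier on an N-th-power setting needs N-fold inflation**: if `Hs ⇒ Statement` (any level), then on every
pin-respecting `H N`-setting carrying a cap `s` with `PN Σ s < (N·PN(j²) − 1)·|log(q)|`, `Hs` is FALSE. With print's cap fixed
(log-different + log-conductor, [IUTchIV] Prop 1.4 / Step (v)) and `N ≥ 2` this is the typed shadow of «the sharper inequalities for N ≥ 2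
are false / the theory breaks down» — a repair must therefore FAIL on N-th-power models. [claim: Mochizuki2012, status: disputed] -/
theorem supplier_false_of_cap_lt_pow (N : ℕ) (Hs : Prop) (hHs : Hs → P.Statement) (hfin : P.ThetaFinite)
    (hindep : ∀ (i i' : Fin T.lstar) (vQ : T.VQ), P.qLocal (Setting.labelSucc i) vQ = P.qLocal (Setting.labelSucc i') vQ)
    (hKumB : (S.col P.n).KummerB (S.D P.n)) (hΘ : ThetaPinned S P ρ) (h : H S P ρ qK N)
    (s : Fin T.lstar → T.VQ → ℝ) (hs : ∀ i, (Function.support (s i)).Finite)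
    (hcap : ∀ (i : Fin T.lstar) (vQ : T.VQ),
      (S.D P.n).logvol _ vQ (P.thetaHull (Setting.labelSucc i) vQ) -
        (S.D P.n).logvol _ vQ (P.thetaRegion3 (Setting.labelSucc i) vQ) ≤ s i vQ)
    (hlt : processionNormalized (fun i : Fin T.lstar => ∑ᶠ vQ : T.VQ, s i vQ) <
      ((N : ℝ) * processionNormalized (fun i : Fin T.lstar => (((i : ℕ) + 1 : ℕ) : ℝ) ^ 2) - 1) * (-P.negLogQ)) :
    ¬ Hs := fun hHs' =>
  (not_le.mpr hlt) (height_bound_pow S P ρ qK N hfin hindep hKumB hΘ h s hs hcap (hHs hHs'))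

/-- **The budget coefficient grows linearly in N**: `N·PN(j²) − 1 ≥ (5N − 2)/2` (`PN(j²) = (l⋇+1)(2l⋇+1)/6 ≥ 5/2` for `l⋇ ≥ 2`); for
`N = 1` it is w4-d103's `c(l⋇) ≥ 3/2`, for `N = 2` already `≥ 4`. [folklore] -/
theorem coeff_pow_ge (N : ℕ) :
    (5 * (N : ℝ) - 2) / 2 ≤ (N : ℝ) * processionNormalized (fun i : Fin T.lstar => (((i : ℕ) + 1 : ℕ) : ℝ) ^ 2) - 1 := by
  have hl : 0 < T.lstar := lt_of_lt_of_le (by norm_num) T.two_le_lstar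
  have h2 : (2 : ℝ) ≤ (T.lstar : ℝ) := by exact_mod_cast T.two_le_lstar
  rw [processionNormalized_labelSq hl]
  have hPN : (5 : ℝ) / 2 ≤ ((T.lstar : ℝ) + 1) * (2 * (T.lstar : ℝ) + 1) / 6 := by
    rw [div_le_div_iff₀ (by norm_num) (by norm_num)]; nlinarith
  have hN : (0 : ℝ) ≤ N := Nat.cast_nonneg N
  nlinarith

end General

/-! ## 3. At the pinned countermodel: the class is the first power exactly -/

section Pinned

open Cor312.Checks Cor312.IdentifiedNonVacuity Cor312Vol.NaiveWitness Cor312Vol.PinnedWitness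

variable (p : ℕ) [hp : Fact p.Prime]

/-- **T-b-type evaluation**: abc-iut-w4-d101's pinned countermodel is a FIRST-POWER model — `H N` holds there IFF `N = 1` (its Θ-image
at label `j` is `B_{j²}`, q-volume `−log p ≠ 0`; w4-d103 `pinned_hscaled`). So for `N ≥ 2` the class FAILS-AT-CM (vacuously «excludes
the countermodel» — it is a model class, not a supplier: T-a n/a). [folklore] -/
theorem H_pinned_iff (N : ℕ) : H (naiveFull p).toLatticeSituation (pinnedSetting p) (orbitRegion p) (qDatum p) N ↔ N = 1 := by
  constructor
  · intro h
    have h0 := h ⟨0, by decide⟩ ()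
    rw [pinned_hscaled p ⟨0, by decide⟩ (), pinned_qLocal_eq] at h0
    have hl := log_p_pos p
    have : ((((0 : ℕ) + 1 : ℕ) : ℝ)) ^ 2 = 1 := by norm_num
    rw [this] at h0
    have hN : (N : ℝ) = 1 := by nlinarith
    exact_mod_cast hN
  · rintro rfl
    exact (H_one_iff _ _ _ _).2 (pinned_hscaled p)

end Pinned

/-! ## 4. The N-th-power pinned model realises the class (bridge to `Repair/CandMochizuki31Tests.lean`, p430074; appended v2) -/

section Pow

open Cor312.Checks Cor312.IdentifiedNonVacuity Cor312Vol.NaiveWitness Cor312Vol.PinnedWitness Repair.CandMochizuki31Tests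

variable (p : ℕ) [hp : Fact p.Prime]

/-- **`H N` HOLDS at the N-th-power pinned model** `powSetting p N` read by `rhoPow p N` (every `N ≥ 1`): the literal bridge from
`CandMochizuki31Tests.pow_hscaledN`. [folklore] -/
theorem H_powSetting (N : ℕ) (hN : 1 ≤ N) : H (naiveFull p).toLatticeSituation (powSetting p N) (rhoPow p N) (qDatum p) N :=
  pow_hscaledN p N hN

/-- **T-c for `H N`, every `N ≥ 1` (row RP-M31)**: typed Thm 3.11 ∧ BridgeHyps ∧ AbsLogQPos ∧ PinnedRegions3 ∧ `H N` ∧ ¬S ∧ ¬Statement at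
`powSetting p N` — the model class is satisfiable together with the whole pinned interface, and the typed Corollary fails there (by
`(5N/2 − 1)·|log q|`). [folklore] -/
theorem H_satisfiable_pow (N : ℕ) (hN : 1 ≤ N) :
    (naiveFull p).Statement ∧ BridgeHyps (powSetting p N) ∧ (powSetting p N).AbsLogQPos ∧
      PinnedRegions3 (naiveFull p).toLatticeSituation (powSetting p N) (rhoPow p N) (qDatum p) ∧
      H (naiveFull p).toLatticeSituation (powSetting p N) (rhoPow p N) (qDatum p) N ∧
      ¬ PilotKummerIndRelated (naiveFull p).toLatticeSituation (powSetting p N) (rhoPow p N) (qDatum p) ∧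
      ¬ (powSetting p N).Statement :=
  ⟨naiveFull_statement p, pow_bridgeHyps p N hN, pow_absLogQPos p N, pow_pinnedRegions3 p N hN, H_powSetting p N hN, pow_not_S p N hN,
    pow_not_statement p N hN⟩

/-- **The budget identity AT the N-th-power model**: there the hull inflation is ZERO in every packet (`pow_thetaHull` = `pow_thetaRegion3`), so
`statement_iff_hullInflation_pow` reads `Statement ↔ (N·PN(j²) − 1)·log p ≤ 0` — false, as `pow_not_statement` says directly. (Instantiates
the identity's hypotheses at a model: `hindep` = `pow_qLocal_indep`, `KummerB` = `naive_partII`, Θ-pin = `pow_thetaPinned`.) [folklore] -/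
theorem statement_iff_at_pow (N : ℕ) (hN : 1 ≤ N) :
    (powSetting p N).Statement ↔
      ((N : ℝ) * processionNormalized (fun i : Fin toyIndex.lstar => (((i : ℕ) + 1 : ℕ) : ℝ) ^ 2) - 1) * (-(powSetting p N).negLogQ) ≤
        processionNormalized (fun i : Fin toyIndex.lstar =>
          ∑ᶠ vQ : toyIndex.VQ, (((naiveFull p).toLatticeSituation.D (powSetting p N).n).logvol _ vQ
              ((powSetting p N).thetaHull (Setting.labelSucc i) vQ) -
            ((naiveFull p).toLatticeSituation.D (powSetting p N).n).logvol _ vQ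
              ((powSetting p N).thetaRegion3 (Setting.labelSucc i) vQ))) :=
  statement_iff_hullInflation_pow (naiveFull p).toLatticeSituation (powSetting p N) (rhoPow p N) (qDatum p) N (pow_thetaFinite p N hN)
    (pow_qLocal_indep p N) (naive_partII p (powSetting p N).n).2.1 (pow_thetaPinned p N hN) (H_powSetting p N hN)

end Pow

end Summit.ABC.IUTFork.Repair.CandMochizuki31

end
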